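import Mathlib.Analysis.LocallyConvex.Separation
import Mathlib.Analysis.LocallyConvex.WithSeminorms
import Mathlib.Topology.ContinuousMap.Weierstrass
import Mathlib.Topology.MetricSpace.Bounded
import Mathlib.Analysis.Convex.Basic
import Mathlib.Algebra.BigOperators.Pi
import Literature.Combinatorics.Additive.RelativeSzemerediCutNorm
import HarnessLib

/-!
# Conlon–Fox–Zhao: proof of the dense model theorem (Theorem 5.1)

Topic `Literature/Combinatorics/Additive`. Source: D. Conlon, J. Fox, Y. Zhao, *The Green–Tao
theorem: an exposition*, EMS Surv. Math. Sci. 1 (2014), 249–282 = arXiv:1403.2957 (held as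
`paper:arxiv-1403.2957`; numbers are those of the arXiv version), §5. This file DISCHARGES the
named fact `Literature.Combinatorics.Additive.CFZ.DenseModel` (Theorem 5.1, file `RelativeSzemerediCutNorm.lean`):

* `CFZ.denseModel_holds : CFZ.DenseModel`,

following the printed proof (Gowers / Reingold–Trevisan–Tulsiani–Vadhan, in Zhao's cut-norm
form) step by step:

* `CFZ.conv e a` — the generalized convolution `(1_{A_1}, …, 1_{A_r})^*` of a cut family,
  normalised so that `⟨h, φ_a⟩ = 𝔼_x h(∑_e x) ∏ 1_{A_l}(x)` (`CFZ.dmInner_conv`), where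
  `CFZ.dmInner f g = 𝔼 f g` is the inner product of §5;
* `CFZ.conv_mul_conv` — **Lemma 5.2**: `φ_a φ_b` is a convex combination of generalized
  convolutions (of the families `(A_l ∩ (B_l - z))_l`, `CFZ.shiftFam`);
* `CFZ.ballGen e` — the set `B = conv(Φ ∪ -Φ) = {∑ c_A φ_A : ∑ |c_A| ≤ 1}`; it is convex,
  compact, closed under multiplication (`CFZ.mul_mem_ballGen`, from Lemma 5.2) and contains `1`;
  its elements pair with `h` to at most `‖h‖` (`CFZ.abs_dmInner_le_of_mem_ballGen`);
* `CFZ.div_mem_ballGen_of_dual` — "the unit ball of the dual norm is the convex hull of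
  `Φ ∪ -Φ`", the inclusion needed, by the separating hyperplane theorem
  (`geometric_hahn_banach_closed_point`); whence the submultiplicativity (5.4) in the form
  `|⟨h, ψ^i⟩| ≤ (‖ψ‖*)^i ‖h‖` (`CFZ.abs_dmInner_pow_le`) and `‖ψ‖_∞ ≤ ‖ψ‖*`
  (`CFZ.abs_le_of_dual`);
* `CFZ.exists_separating` — the separation of `f` from `K₁ + K₂` (Hahn–Banach for the compact
  convex `f - K₁` and the closed convex `K₂`, `geometric_hahn_banach_compact_closed`), giving `ψ`
  with (a) `⟨f,ψ⟩ > 1`, (b) `⟨g,ψ⟩ < 1` on `K₁ + K₂`; `CFZ.dual_bound_of_separating` — (b) on `K₂`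
  gives `‖ψ‖* ≤ 2/ε`;
* `CFZ.exists_predense_model` — the contradiction `1 < ⟨f,ψ⟩ ≤ ⟨ν,ψ₊⟩ ≤ ⟨ν, Pψ⟩ + ‖ν‖₁ε/8 ≤
  (1+ε/2)⁻¹ + ε/8 + ε'R + (1+ε')ε/8 ≤ 1` with a Weierstrass polynomial `P`
  (`exists_polynomial_near_of_continuousOn`), `|P(x) - x₊| ≤ ε/8` on `[-2/ε, 2/ε]`,
  `R = ∑ |p_i| (2/ε)^i`, `ε' = ε/(8(R+1))`, `ε ≤ 1/10` (`CFZ.dm_numeric`);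
* `CFZ.denseModel_holds` — WLOG `ε ≤ 1/10`, the model `f̃ : ℤ_N → [0, 1+ε/2]`, and its cap
  `f̃ ∧ 1`.

The cut norm enters only through the predicate `CFZ.HasSmallCut` ("`‖·‖ ≤ t`"); the dual norm
`‖ψ‖*` is likewise handled through the bound "`‖h‖ ≤ t ⇒ |⟨h,ψ⟩| ≤ M t`". The degenerate case
`e = ∅` (`r = 0`, where `‖F‖ = |F(0)|`) is treated separately.

## References
* D. Conlon, J. Fox, Y. Zhao, *The Green–Tao theorem: an exposition*, EMS Surv. Math. Sci. 1
  (2014), 249–282, §5: Lemma 5.2, (5.4), Theorem 5.1 and its proof. [cite: ConlonFoxZhao2014]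
* Y. Zhao, *An arithmetic transference proof of a relative Szemerédi theorem*, Math. Proc.
  Cambridge Philos. Soc. 156 (2014), 255–261.
* W. T. Gowers, *Decompositions, approximate structure, transference, and the Hahn–Banach
  theorem*, Bull. Lond. Math. Soc. 42 (2010), 573–606.
-/

noncomputable section

open Finset
open scoped BigOperators

namespace Literature.Combinatorics.Additive.CFZ

/-! ## Proof of the dense model theorem (Theorem 5.1) -/

section DenseModelProof

variable {ι : Type*} [Fintype ι] [DecidableEq ι] {N : ℕ} [NeZero N]

/-- The inner product `⟨f, g⟩ = 𝔼_x f(x) g(x)` on functions `ℤ_N → ℝ` (§5).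
[cite: ConlonFoxZhao2014, Section 5] -/
def dmInner (f g : ZMod N → ℝ) : ℝ := 𝔼 z, f z * g z

/-- The generalized convolution `(1_{A_1}, …, 1_{A_r})^*` of a cut family (§5):
`φ_a(w) = N · 𝔼_x [∑_{i ∈ e} x_i = w] ∏_l 1_{A_l}(x)`, normalised so that
`⟨h, φ_a⟩ = 𝔼_x h(∑_e x) ∏_l 1_{A_l}(x)` (`dmInner_conv`). [cite: ConlonFoxZhao2014, Section 5] -/
def conv (e : Finset ι) (a : ι → (ι → ZMod N) → ℝ) (w : ZMod N) : ℝ :=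
  (N : ℝ) * 𝔼 x : ι → ZMod N, if ∑ i ∈ e, x i = w then ∏ l ∈ e, a l x else 0

omit [DecidableEq ι] in
/-- A one-point average over `ℤ_N`. [folklore] -/
theorem expect_ite_eq_div (c : ZMod N) (F : ZMod N → ℝ) :
    (𝔼 w : ZMod N, if c = w then F w else 0) = F c / N := by
  rw [Fintype.expect_eq_sum_div_card, Finset.sum_ite_eq, if_pos (Finset.mem_univ _), ZMod.card]

/-- `⟨h, φ_a⟩ = 𝔼_x h(∑_{i ∈ e} x_i) ∏_l 1_{A_l}(x)` ("by a change of variable",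
§5). [cite: ConlonFoxZhao2014, Section 5] -/
theorem dmInner_conv (e : Finset ι) (h : ZMod N → ℝ) (a : ι → (ι → ZMod N) → ℝ) :
    dmInner h (conv e a) = cutAverage e (fun x => h (∑ i ∈ e, x i)) a := by
  have hN : (N : ℝ) ≠ 0 := Nat.cast_ne_zero.mpr (NeZero.ne N)
  unfold dmInner conv cutAverage
  calc (𝔼 w : ZMod N, h w * ((N : ℝ) * 𝔼 x : ι → ZMod N,
          if ∑ i ∈ e, x i = w then ∏ l ∈ e, a l x else 0))
      = 𝔼 w : ZMod N, 𝔼 x : ι → ZMod N,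
          (N : ℝ) * (if ∑ i ∈ e, x i = w then h w * ∏ l ∈ e, a l x else 0) := by
        refine Finset.expect_congr rfl fun w _ => ?_
        rw [← mul_assoc, Finset.mul_expect]
        refine Finset.expect_congr rfl fun x _ => ?_
        split_ifs <;> ring
    _ = 𝔼 x : ι → ZMod N, 𝔼 w : ZMod N,
          (N : ℝ) * (if ∑ i ∈ e, x i = w then h w * ∏ l ∈ e, a l x else 0) :=
        Finset.expect_comm _ _ _
    _ = 𝔼 x : ι → ZMod N, h (∑ i ∈ e, x i) * ∏ l ∈ e, a l x := by
        refine Finset.expect_congr rfl fun x _ => ?_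
        rw [← Finset.mul_expect, expect_ite_eq_div, mul_div_cancel₀ _ hN]

/-- The trivial family convolves to the constant `1` (`e ≠ ∅`). [folklore] -/
theorem conv_one {e : Finset ι} (he : e.Nonempty) :
    conv e (fun (_ : ι) (_ : ι → ZMod N) => (1 : ℝ)) = fun _ => 1 := by
  have hN : (N : ℝ) ≠ 0 := Nat.cast_ne_zero.mpr (NeZero.ne N)
  funext w
  unfold conv
  simp only [Finset.prod_const_one]
  rw [expect_comp_sum_eq he (fun z : ZMod N => if z = w then (1 : ℝ) else 0)]
  have : (𝔼 z : ZMod N, if z = w then (1 : ℝ) else 0) = 1 / N := by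
    rw [Fintype.expect_eq_sum_div_card, Finset.sum_ite_eq', if_pos (Finset.mem_univ _), ZMod.card]
  rw [this, mul_one_div_cancel hN]

/-- The cut family `(A_l ∩ (B_l - z))_l` of the proof of Lemma 5.2: `1_{A_l}(x) 1_{B_l}(x + z)`.
[cite: ConlonFoxZhao2014, Lemma 5.2] -/
def shiftFam (a b : ι → (ι → ZMod N) → ℝ) (z : ι → ZMod N) : ι → (ι → ZMod N) → ℝ :=
  fun l x => a l x * b l (x + z)

omit [Fintype ι] [NeZero N] in
/-- `shiftFam` of cut families is a cut family. [cite: ConlonFoxZhao2014, Lemma 5.2] -/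
theorem isCutFamily_shiftFam {e : Finset ι} {a b : ι → (ι → ZMod N) → ℝ} (ha : IsCutFamily e a)
    (hb : IsCutFamily e b) (z : ι → ZMod N) : IsCutFamily e (shiftFam a b z) := by
  refine ⟨fun l x => ?_, fun l hl x y hxy => ?_⟩
  · rcases ha.zero_or_one l x with h | h <;> rcases hb.zero_or_one l (x + z) with h' | h' <;>
      simp [shiftFam, h, h']
  · simp only [shiftFam]
    rw [ha.dependsOn l hl hxy, hb.dependsOn l hl (x := x + z) (y := y + z) fun i hi => by
      simp only [Pi.add_apply, hxy i hi]]

/-- **Lemma 5.2 (the generalized convolutions are closed under multiplication, up to convex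
combinations).** `φ_a φ_b = N · 𝔼_{z : ∑_e z = 0} φ_{(A_l ∩ (B_l - z))_l}` pointwise — a convex
combination (the weights `N/N^{|ι|} [∑_e z = 0]` sum to `1`) of generalized convolutions.
[cite: ConlonFoxZhao2014, Lemma 5.2] -/
theorem conv_mul_conv (e : Finset ι) (a b : ι → (ι → ZMod N) → ℝ) (w : ZMod N) :
    conv e a w * conv e b w =
      (N : ℝ) * 𝔼 z : ι → ZMod N,
        if ∑ i ∈ e, z i = 0 then conv e (shiftFam a b z) w else 0 := by
  unfold conv
  -- substitute `y = x + z` in the second average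
  have hsub : ∀ x : ι → ZMod N,
      (𝔼 y : ι → ZMod N, if ∑ i ∈ e, y i = w then ∏ l ∈ e, b l y else 0) =
        𝔼 z : ι → ZMod N, if ∑ i ∈ e, (x i + z i) = w then ∏ l ∈ e, b l (x + z) else 0 := by
    intro x
    rw [← Fintype.expect_equiv (Equiv.addLeft x)]
    intro z
    rfl
  calc ((N : ℝ) * 𝔼 x : ι → ZMod N, if ∑ i ∈ e, x i = w then ∏ l ∈ e, a l x else 0) *
        ((N : ℝ) * 𝔼 y : ι → ZMod N, if ∑ i ∈ e, y i = w then ∏ l ∈ e, b l y else 0)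
      = (N : ℝ) * ((N : ℝ) * 𝔼 x : ι → ZMod N, 𝔼 z : ι → ZMod N,
          ((if ∑ i ∈ e, x i = w then ∏ l ∈ e, a l x else 0) *
            (if ∑ i ∈ e, (x i + z i) = w then ∏ l ∈ e, b l (x + z) else 0))) := by
        have key : (𝔼 x : ι → ZMod N, if ∑ i ∈ e, x i = w then ∏ l ∈ e, a l x else (0 : ℝ)) *
            (𝔼 y : ι → ZMod N, if ∑ i ∈ e, y i = w then ∏ l ∈ e, b l y else (0 : ℝ)) =
            𝔼 x : ι → ZMod N, 𝔼 z : ι → ZMod N,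
              ((if ∑ i ∈ e, x i = w then ∏ l ∈ e, a l x else 0) *
                (if ∑ i ∈ e, (x i + z i) = w then ∏ l ∈ e, b l (x + z) else 0)) := by
          rw [Finset.expect_mul]
          refine Finset.expect_congr rfl fun x _ => ?_
          rw [hsub x, Finset.mul_expect]
        rw [← key]
        ring
    _ = (N : ℝ) * ((N : ℝ) * 𝔼 z : ι → ZMod N, 𝔼 x : ι → ZMod N,
          ((if ∑ i ∈ e, x i = w then ∏ l ∈ e, a l x else 0) *
            (if ∑ i ∈ e, (x i + z i) = w then ∏ l ∈ e, b l (x + z) else 0))) := by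
        rw [Finset.expect_comm]
    _ = (N : ℝ) * 𝔼 z : ι → ZMod N, if ∑ i ∈ e, z i = 0 then
          (N : ℝ) * 𝔼 x : ι → ZMod N,
            (if ∑ i ∈ e, x i = w then ∏ l ∈ e, shiftFam a b z l x else 0) else 0 := by
        congr 1
        rw [Finset.mul_expect]
        refine Finset.expect_congr rfl fun z _ => ?_
        by_cases hz : ∑ i ∈ e, z i = 0
        · rw [if_pos hz]
          congr 1
          refine Finset.expect_congr rfl fun x _ => ?_
          by_cases hx : ∑ i ∈ e, x i = w
          · rw [if_pos hx, if_pos (by rw [Finset.sum_add_distrib, hx, hz, add_zero]), if_pos hx,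
              ← Finset.prod_mul_distrib]
            rfl
          · rw [if_neg hx, zero_mul, if_neg hx]
        · rw [if_neg hz]
          convert (mul_zero (N : ℝ)) using 2
          refine Finset.expect_eq_zero fun x _ => ?_
          by_cases hx : ∑ i ∈ e, x i = w
          · rw [if_pos hx, if_neg, mul_zero]
            rw [Finset.sum_add_distrib, hx]
            intro h
            exact hz (by simpa using h)
          · rw [if_neg hx, zero_mul]

/-- The weights of Lemma 5.2 sum to one: `N · 𝔼_z [∑_e z = 0] = 1` (`e ≠ ∅`). [folklore] -/
theorem expect_ite_sum_eq_zero {e : Finset ι} (he : e.Nonempty) :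
    (N : ℝ) * 𝔼 z : ι → ZMod N, (if ∑ i ∈ e, z i = 0 then (1 : ℝ) else 0) = 1 := by
  have hN : (N : ℝ) ≠ 0 := Nat.cast_ne_zero.mpr (NeZero.ne N)
  rw [expect_comp_sum_eq he (fun u : ZMod N => if u = 0 then (1 : ℝ) else 0)]
  rw [Fintype.expect_eq_sum_div_card, Finset.sum_ite_eq', if_pos (Finset.mem_univ _), ZMod.card,
    mul_one_div_cancel hN]

end DenseModelProof

end Literature.Combinatorics.Additive.CFZ

namespace Literature.Combinatorics.Additive.CFZ

section DenseModelBall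

variable {ι : Type*} [Fintype ι] [DecidableEq ι]

/-- The cut family attached to a family of finite sets of points. [folklore] -/
def famOf {N : ℕ} (A : ι → Finset (ι → ZMod N)) : ι → (ι → ZMod N) → ℝ :=
  fun l x => if x ∈ A l then 1 else 0

/-- The (finite) type of cut families on `e`, indexed by families of finite sets.
[cite: ConlonFoxZhao2014, Section 5] -/
abbrev CutIdx (e : Finset ι) (N : ℕ) : Type _ :=
  {A : ι → Finset (ι → ZMod N) // IsCutFamily e (famOf A)}

/-- `CutIdx e N` is finite. [folklore] -/
noncomputable instance instFintypeCutIdx (e : Finset ι) (N : ℕ) [NeZero N] :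
    Fintype (CutIdx e N) := by
  classical exact Subtype.fintype _

variable {N : ℕ} [NeZero N]

/-- Every cut family is indexed. [folklore] -/
theorem exists_cutIdx {e : Finset ι} {a : ι → (ι → ZMod N) → ℝ} (ha : IsCutFamily e a) :
    ∃ A : CutIdx e N, famOf A.1 = a := by
  classical
  have key : famOf (fun l => univ.filter fun x => a l x = 1) = a := by
    funext l x
    rcases ha.zero_or_one l x with h | h <;> simp [famOf, h]
  exact ⟨⟨fun l => univ.filter fun x => a l x = 1, by rw [key]; exact ha⟩, key⟩

/-- The candidate unit ball of the dual norm,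
`B = conv(Φ ∪ -Φ) = {∑_A c_A φ_A : ∑_A |c_A| ≤ 1}`, `Φ` the set of generalized convolutions
(§5: "the unit ball for this dual norm is the convex hull of the union of `Φ` and `-Φ`").
[cite: ConlonFoxZhao2014, Section 5] -/
def ballGen (e : Finset ι) : Set (ZMod N → ℝ) :=
  (fun c : CutIdx e N → ℝ => ∑ A, c A • conv e (famOf A.1)) '' {c | ∑ A, |c A| ≤ 1}

/-- Elements of `B` pair with `h` to at most `‖h‖`: if `‖h‖_{□} ≤ t` then `|⟨h, u⟩| ≤ t` for
`u ∈ B` ("each element of `Φ ∪ (-Φ)` is in the unit ball and … the same holds for convex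
combinations", §5). [cite: ConlonFoxZhao2014, Section 5] -/
theorem abs_dmInner_le_of_mem_ballGen {e : Finset ι} {u h : ZMod N → ℝ} (hu : u ∈ ballGen e)
    {t : ℝ} (ht : HasSmallCut e (fun x : ι → ZMod N => h (∑ i ∈ e, x i)) t) :
    |dmInner h u| ≤ t := by
  obtain ⟨c, hc, rfl⟩ := hu
  have hlin : dmInner h (∑ A, c A • conv e (famOf A.1)) =
      ∑ A, c A * dmInner h (conv e (famOf A.1)) := by
    unfold dmInner
    calc (𝔼 z, h z * (∑ A, c A • conv e (famOf A.1)) z)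
        = 𝔼 z, ∑ A, c A * (h z * conv e (famOf A.1) z) := by
          refine Finset.expect_congr rfl fun z _ => ?_
          rw [Finset.sum_apply, Finset.mul_sum]
          refine Finset.sum_congr rfl fun A _ => ?_
          rw [Pi.smul_apply, smul_eq_mul]; ring
      _ = ∑ A, 𝔼 z, c A * (h z * conv e (famOf A.1) z) := Finset.expect_sum_comm _ _ _
      _ = ∑ A, c A * 𝔼 z, h z * conv e (famOf A.1) z := by
          refine Finset.sum_congr rfl fun A _ => ?_
          rw [Finset.mul_expect]
  rw [hlin]
  refine (Finset.abs_sum_le_sum_abs _ _).trans ?_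
  have hb : ∀ A : CutIdx e N, |c A * dmInner h (conv e (famOf A.1))| ≤ |c A| * t := by
    intro A
    rw [abs_mul]
    refine mul_le_mul_of_nonneg_left ?_ (abs_nonneg _)
    rw [dmInner_conv]
    exact ht _ A.2
  refine (Finset.sum_le_sum fun A _ => hb A).trans ?_
  rw [← Finset.sum_mul]
  exact mul_le_of_le_one_left ht.nonneg hc

/-- `Φ ⊆ B`. [folklore] -/
theorem conv_mem_ballGen {e : Finset ι} (A : CutIdx e N) : conv e (famOf A.1) ∈ ballGen e := by
  classical
  refine ⟨fun B => if B = A then 1 else 0, ?_, ?_⟩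
  · show ∑ B, |(if B = A then (1 : ℝ) else 0)| ≤ 1
    simp only [apply_ite abs, abs_one, abs_zero, Finset.sum_ite_eq', Finset.mem_univ, if_true]
    rfl
  · simp

/-- `-B ⊆ B`. [folklore] -/
theorem neg_mem_ballGen {e : Finset ι} {u : ZMod N → ℝ} (hu : u ∈ ballGen e) :
    -u ∈ ballGen e := by
  obtain ⟨c, hc, rfl⟩ := hu
  refine ⟨fun A => -c A, by simpa using hc, ?_⟩
  simp [Finset.sum_neg_distrib, neg_smul]

/-- `0 ∈ B`. [folklore] -/
theorem zero_mem_ballGen (e : Finset ι) : (0 : ZMod N → ℝ) ∈ ballGen e :=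
  ⟨0, by simp, by simp⟩

/-- `B` is convex. [folklore] -/
theorem convex_ballGen (e : Finset ι) : Convex ℝ (ballGen (N := N) e) := by
  intro u hu v hv p q hp hq hpq
  obtain ⟨c, hc, rfl⟩ := hu
  obtain ⟨d, hd, rfl⟩ := hv
  have hc' : ∑ A, |c A| ≤ 1 := hc
  have hd' : ∑ A, |d A| ≤ 1 := hd
  refine ⟨fun A => p * c A + q * d A, ?_, ?_⟩
  · calc ∑ A, |p * c A + q * d A| ≤ ∑ A, (p * |c A| + q * |d A|) :=
          Finset.sum_le_sum fun A _ => (abs_add_le _ _).trans (by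
            rw [abs_mul, abs_mul, abs_of_nonneg hp, abs_of_nonneg hq])
      _ = p * ∑ A, |c A| + q * ∑ A, |d A| := by
          rw [Finset.sum_add_distrib, Finset.mul_sum, Finset.mul_sum]
      _ ≤ p * 1 + q * 1 := by gcongr
      _ = 1 := by rw [mul_one, mul_one, hpq]
  · simp only [add_smul, Finset.sum_add_distrib, mul_smul, ← Finset.smul_sum]

/-- `B` is compact (the image of the `ℓ¹` unit ball of a finite-dimensional space).
[folklore] -/
theorem isCompact_ballGen (e : Finset ι) : IsCompact (ballGen (N := N) e) := by
  refine IsCompact.image (Metric.isCompact_of_isClosed_isBounded ?_ ?_) ?_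
  · exact isClosed_le (continuous_finsetSum _ fun A _ => (continuous_apply A).abs)
      continuous_const
  · refine (Metric.isBounded_closedBall (x := (0 : CutIdx e N → ℝ)) (r := 1)).subset ?_
    intro c hc
    rw [Metric.mem_closedBall, dist_zero_right, pi_norm_le_iff_of_nonneg zero_le_one]
    intro A
    rw [Real.norm_eq_abs]
    exact (Finset.single_le_sum (fun B _ => abs_nonneg (c B)) (Finset.mem_univ A)).trans hc
  · exact continuous_finsetSum _ fun A _ => (continuous_apply A).smul continuous_const

/-- `B` is closed. [folklore] -/
theorem isClosed_ballGen (e : Finset ι) : IsClosed (ballGen (N := N) e) :=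
  (isCompact_ballGen e).isClosed

/-- The index of the cut family `(A_l ∩ (B_l - z))_l` of Lemma 5.2.
[cite: ConlonFoxZhao2014, Lemma 5.2] -/
def shiftIdx {e : Finset ι} (A B : CutIdx e N) (z : ι → ZMod N) : CutIdx e N :=
  ⟨fun l => univ.filter fun x => x ∈ A.1 l ∧ x + z ∈ B.1 l, by
    have key : famOf (fun l => univ.filter fun x => x ∈ A.1 l ∧ x + z ∈ B.1 l) =
        shiftFam (famOf A.1) (famOf B.1) z := by
      funext l x
      by_cases h1 : x ∈ A.1 l <;> by_cases h2 : x + z ∈ B.1 l <;> simp [famOf, shiftFam, h1, h2]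
    rw [key]
    exact isCutFamily_shiftFam A.2 B.2 z⟩

/-- The family indexed by `shiftIdx`. [cite: ConlonFoxZhao2014, Lemma 5.2] -/
theorem famOf_shiftIdx {e : Finset ι} (A B : CutIdx e N) (z : ι → ZMod N) :
    famOf (shiftIdx A B z).1 = shiftFam (famOf A.1) (famOf B.1) z := by
  funext l x
  by_cases h1 : x ∈ A.1 l <;> by_cases h2 : x + z ∈ B.1 l <;>
    simp [famOf, shiftFam, shiftIdx, h1, h2]

/-- Lemma 5.2 for indexed families: `φ_A φ_B = ∑_z w_z φ_{shiftIdx A B z}` with the weights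
`w_z = (N / N^{|ι|}) [∑_e z = 0]`. [cite: ConlonFoxZhao2014, Lemma 5.2] -/
theorem conv_mul_conv_eq_sum {e : Finset ι} (A B : CutIdx e N) :
    conv e (famOf A.1) * conv e (famOf B.1) =
      ∑ z : ι → ZMod N, ((N : ℝ) / Fintype.card (ι → ZMod N) *
        (if ∑ i ∈ e, z i = 0 then (1 : ℝ) else 0)) • conv e (famOf (shiftIdx A B z).1) := by
  funext w
  rw [Pi.mul_apply, conv_mul_conv, Finset.sum_apply, Fintype.expect_eq_sum_div_card,
    ← mul_comm_div, Finset.mul_sum]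
  refine Finset.sum_congr rfl fun z _ => ?_
  rw [Pi.smul_apply, smul_eq_mul, famOf_shiftIdx]
  split_ifs <;> ring

/-- The weights of Lemma 5.2 sum to `1`. [folklore] -/
theorem sum_weights_eq_one {e : Finset ι} (he : e.Nonempty) :
    ∑ z : ι → ZMod N, (N : ℝ) / Fintype.card (ι → ZMod N) *
      (if ∑ i ∈ e, z i = 0 then (1 : ℝ) else 0) = 1 := by
  rw [← Finset.mul_sum, mul_comm_div, ← Fintype.expect_eq_sum_div_card]
  exact expect_ite_sum_eq_zero he

/-- **`B` is closed under multiplication** (from Lemma 5.2: "this now implies that the unit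
ball for the dual norm is closed under multiplication").
[cite: ConlonFoxZhao2014, Lemma 5.2 and (5.4)] -/
theorem mul_mem_ballGen {e : Finset ι} (he : e.Nonempty) {u v : ZMod N → ℝ}
    (hu : u ∈ ballGen e) (hv : v ∈ ballGen e) : u * v ∈ ballGen e := by
  classical
  obtain ⟨c, hc, rfl⟩ := hu
  obtain ⟨d, hd, rfl⟩ := hv
  have hc' : ∑ A, |c A| ≤ 1 := hc
  have hd' : ∑ A, |d A| ≤ 1 := hd
  -- the weights and the relabelling map of Lemma 5.2
  set wt : (ι → ZMod N) → ℝ := fun z => (N : ℝ) / Fintype.card (ι → ZMod N) *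
    (if ∑ i ∈ e, z i = 0 then (1 : ℝ) else 0) with hwt
  have hwt0 : ∀ z, 0 ≤ wt z := fun z => by
    simp only [hwt]; split_ifs <;> positivity
  have hwt1 : ∑ z, wt z = 1 := sum_weights_eq_one he
  let T := CutIdx e N × CutIdx e N × (ι → ZMod N)
  let κ : T → ℝ := fun t => c t.1 * d t.2.1 * wt t.2.2
  let m : T → CutIdx e N := fun t => shiftIdx t.1 t.2.1 t.2.2
  -- the product as a combination over `T`
  have hprod : (∑ A, c A • conv e (famOf A.1)) * (∑ B, d B • conv e (famOf B.1)) =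
      ∑ t : T, κ t • conv e (famOf (m t).1) := by
    rw [Finset.sum_mul_sum]
    simp only [T, κ, m, Fintype.sum_prod_type]
    refine Finset.sum_congr rfl fun A _ => Finset.sum_congr rfl fun B _ => ?_
    rw [smul_mul_smul_comm, conv_mul_conv_eq_sum, Finset.smul_sum]
    refine Finset.sum_congr rfl fun z _ => ?_
    rw [smul_smul]
  -- regroup along the fibres of `m`
  have hfib : ∑ t : T, κ t • conv e (famOf (m t).1) =
      ∑ A', (∑ t ∈ univ.filter (fun t => m t = A'), κ t) • conv e (famOf A'.1) := by
    rw [← Finset.sum_fiberwise_of_maps_to (g := m) (t := univ) (fun t _ => Finset.mem_univ _)]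
    refine Finset.sum_congr rfl fun A' _ => ?_
    rw [Finset.sum_smul]
    refine Finset.sum_congr rfl fun t ht => ?_
    rw [(Finset.mem_filter.mp ht).2]
  refine ⟨fun A' => ∑ t ∈ univ.filter (fun t => m t = A'), κ t, ?_, ?_⟩
  · calc ∑ A', |∑ t ∈ univ.filter (fun t => m t = A'), κ t|
          ≤ ∑ A', ∑ t ∈ univ.filter (fun t => m t = A'), |κ t| :=
            Finset.sum_le_sum fun A' _ => Finset.abs_sum_le_sum_abs _ _
      _ = ∑ t : T, |κ t| :=
            Finset.sum_fiberwise_of_maps_to (fun t _ => Finset.mem_univ (m t)) _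
      _ = (∑ A, |c A|) * (∑ B, |d B|) * ∑ z, wt z := by
            simp only [T, κ, Fintype.sum_prod_type]
            rw [Finset.sum_mul_sum, Finset.sum_mul]
            refine Finset.sum_congr rfl fun A _ => ?_
            rw [Finset.sum_mul]
            refine Finset.sum_congr rfl fun B _ => ?_
            rw [Finset.mul_sum]
            refine Finset.sum_congr rfl fun z _ => ?_
            rw [abs_mul, abs_mul, abs_of_nonneg (hwt0 z)]
      _ ≤ 1 := by
            rw [hwt1, mul_one]
            have h3 : 0 ≤ ∑ B, |d B| := Finset.sum_nonneg fun _ _ => abs_nonneg _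
            have h4 : 0 ≤ ∑ A, |c A| := Finset.sum_nonneg fun _ _ => abs_nonneg _
            nlinarith
  · show ∑ A', (∑ t ∈ univ.filter (fun t => m t = A'), κ t) • conv e (famOf A'.1) = _
    rw [hprod, hfib]

end DenseModelBall

end Literature.Combinatorics.Additive.CFZ

namespace Literature.Combinatorics.Additive.CFZ

section DenseModelMain

variable {ι : Type*} [Fintype ι] [DecidableEq ι] {N : ℕ} [NeZero N]

/-- `1 ∈ B` (`1` is the convolution of the trivial family). [folklore] -/
theorem one_mem_ballGen {e : Finset ι} (he : e.Nonempty) : (1 : ZMod N → ℝ) ∈ ballGen e := by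
  have h1 : famOf (fun _ : ι => (univ : Finset (ι → ZMod N))) = fun _ _ => (1 : ℝ) := by
    funext l x; simp [famOf]
  have hmem := conv_mem_ballGen (e := e) ⟨fun _ => univ, by rw [h1]; exact isCutFamily_one e⟩
  simp only [h1, conv_one he] at hmem
  exact hmem

/-- `B` is closed under powers. [cite: ConlonFoxZhao2014, Section 5, (5.4)] -/
theorem pow_mem_ballGen {e : Finset ι} (he : e.Nonempty) {u : ZMod N → ℝ} (hu : u ∈ ballGen e)
    (n : ℕ) : u ^ n ∈ ballGen e := by
  induction n with
  | zero => rw [pow_zero]; exact one_mem_ballGen he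
  | succ n ih => rw [pow_succ]; exact mul_mem_ballGen he ih hu

/-- Continuous linear functionals on `ℝ^{ℤ_N}` are represented by `⟨h₀, ·⟩`. [folklore] -/
theorem exists_dmInner_eq (L : StrongDual ℝ (ZMod N → ℝ)) :
    ∃ h₀ : ZMod N → ℝ, ∀ g, L g = dmInner h₀ g := by
  classical
  refine ⟨fun z => (N : ℝ) * L (fun j => if z = j then 1 else 0), fun g => ?_⟩
  have hN : (N : ℝ) ≠ 0 := Nat.cast_ne_zero.mpr (NeZero.ne N)
  unfold dmInner
  rw [Fintype.expect_eq_sum_div_card, ZMod.card]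
  conv_lhs => rw [pi_eq_sum_univ g, map_sum]
  rw [eq_div_iff hN, Finset.sum_mul]
  refine Finset.sum_congr rfl fun z _ => ?_
  rw [map_smul, smul_eq_mul]
  ring

/-- **The unit ball of the dual norm is contained in `B`** (§5, "by the separating hyperplane
theorem"): if `|⟨h, ψ⟩| ≤ M ‖h‖` for all `h` (in the form: `‖h‖_□ ≤ t ⇒ |⟨h,ψ⟩| ≤ M t`), then
`ψ / M ∈ B`. [cite: ConlonFoxZhao2014, Section 5] -/
theorem div_mem_ballGen_of_dual {e : Finset ι} {ψ : ZMod N → ℝ} {M : ℝ} (hM : 0 < M)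
    (hψ : ∀ (h : ZMod N → ℝ) (t : ℝ), 0 < t →
      HasSmallCut e (fun x : ι → ZMod N => h (∑ i ∈ e, x i)) t → |dmInner h ψ| ≤ M * t) :
    (fun z => ψ z / M) ∈ ballGen e := by
  by_contra hnot
  obtain ⟨L, s, hLs, hsψ⟩ :=
    geometric_hahn_banach_closed_point (convex_ballGen e) (isClosed_ballGen e) hnot
  obtain ⟨h₀, hh₀⟩ := exists_dmInner_eq L
  have hs : 0 < s := by simpa [hh₀, dmInner] using hLs 0 (zero_mem_ballGen e)
  -- `‖h₀‖_□ ≤ s`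
  have hcut : HasSmallCut e (fun x : ι → ZMod N => h₀ (∑ i ∈ e, x i)) s := by
    intro a ha
    obtain ⟨A, rfl⟩ := exists_cutIdx ha
    rw [← dmInner_conv, abs_le]
    constructor
    · have := hLs _ (neg_mem_ballGen (conv_mem_ballGen A))
      rw [hh₀] at this
      unfold dmInner at this ⊢
      simp only [Pi.neg_apply, mul_neg, expect_neg_distrib] at this
      linarith
    · have := hLs _ (conv_mem_ballGen A)
      rw [hh₀] at this
      exact this.le
  have h1 := hψ h₀ s hs hcut
  have h2 : s < dmInner h₀ (fun z => ψ z / M) := by rw [← hh₀]; exact hsψ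
  have h3 : dmInner h₀ (fun z => ψ z / M) = dmInner h₀ ψ / M := by
    unfold dmInner
    rw [Finset.expect_div]
    exact Finset.expect_congr rfl fun z _ => by ring
  rw [h3, lt_div_iff₀ hM] at h2
  have h4 := (abs_le.mp h1).2
  linarith [mul_comm s M]

/-- Powers of `ψ` against `h`: `|⟨h, ψ^n⟩| ≤ M^n ‖h‖` — the submultiplicativity (5.4) of the dual
norm in the form used in the proof of Thm. 5.1 (`‖ψ^i‖* ≤ (‖ψ‖*)^i`).
[cite: ConlonFoxZhao2014, Section 5, (5.4)] -/
theorem abs_dmInner_pow_le {e : Finset ι} (he : e.Nonempty) {ψ : ZMod N → ℝ} {M : ℝ}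
    (hM : 0 < M)
    (hψ : ∀ (h : ZMod N → ℝ) (t : ℝ), 0 < t →
      HasSmallCut e (fun x : ι → ZMod N => h (∑ i ∈ e, x i)) t → |dmInner h ψ| ≤ M * t)
    {h : ZMod N → ℝ} {t : ℝ} (ht : HasSmallCut e (fun x : ι → ZMod N => h (∑ i ∈ e, x i)) t)
    (n : ℕ) : |dmInner h (ψ ^ n)| ≤ M ^ n * t := by
  have hmem := pow_mem_ballGen he (div_mem_ballGen_of_dual hM hψ) n
  have hb := abs_dmInner_le_of_mem_ballGen hmem ht
  have heq : dmInner h (ψ ^ n) = M ^ n * dmInner h ((fun z => ψ z / M) ^ n) := by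
    unfold dmInner
    rw [Finset.mul_expect]
    refine Finset.expect_congr rfl fun z _ => ?_
    simp only [Pi.pow_apply, div_pow]
    field_simp
  rw [heq, abs_mul, abs_pow, abs_of_pos hM]
  exact mul_le_mul_of_nonneg_left hb (by positivity)

/-- `‖·‖_∞ ≤ ‖·‖*` (§5: "letting `x'` be a value for which `ψ` achieves its maximum and taking
`f(x) = N` for `x = x'` and `0` otherwise"): `|ψ(x')| ≤ M`. [cite: ConlonFoxZhao2014, Section 5] -/
theorem abs_le_of_dual {e : Finset ι} (he : e.Nonempty) {ψ : ZMod N → ℝ} {M : ℝ}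
    (hψ : ∀ (h : ZMod N → ℝ) (t : ℝ), 0 < t →
      HasSmallCut e (fun x : ι → ZMod N => h (∑ i ∈ e, x i)) t → |dmInner h ψ| ≤ M * t)
    (x' : ZMod N) : |ψ x'| ≤ M := by
  classical
  have hN : (N : ℝ) ≠ 0 := Nat.cast_ne_zero.mpr (NeZero.ne N)
  set h : ZMod N → ℝ := fun z => if z = x' then (N : ℝ) else 0 with hh
  have hcut : HasSmallCut e (fun x : ι → ZMod N => h (∑ i ∈ e, x i)) 1 := by
    intro a ha
    refine (abs_cutAverage_le_expect_abs _ ha).trans ?_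
    rw [expect_comp_sum_eq he (fun z => |h z|)]
    have : (𝔼 z : ZMod N, |h z|) = 1 := by
      simp only [hh, apply_ite abs, abs_zero, Nat.abs_cast]
      rw [Fintype.expect_eq_sum_div_card, Finset.sum_ite_eq', if_pos (Finset.mem_univ _),
        ZMod.card, div_self hN]
    rw [this]
  have h1 := hψ h 1 one_pos hcut
  have h2 : dmInner h ψ = ψ x' := by
    unfold dmInner
    simp only [hh, ite_mul, zero_mul]
    rw [Fintype.expect_eq_sum_div_card, Finset.sum_ite_eq', if_pos (Finset.mem_univ _), ZMod.card]
    field_simp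
  rw [h2, mul_one] at h1
  exact h1

end DenseModelMain

end Literature.Combinatorics.Additive.CFZ

namespace Literature.Combinatorics.Additive.CFZ

section DenseModelTheorem

variable {ι : Type*} [Fintype ι] [DecidableEq ι] {N : ℕ} [NeZero N]

/-- Continuity of `h ↦ 𝔼_x h(∑_e x) ∏_l 1_{A_l}(x)`. [folklore] -/
theorem continuous_cutAverage_comp_sum (e : Finset ι) (a : ι → (ι → ZMod N) → ℝ) :
    Continuous fun h : ZMod N → ℝ =>
      cutAverage e (fun x : ι → ZMod N => h (∑ i ∈ e, x i)) a := by
  unfold cutAverage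
  simp only [Finset.expect_eq_sum_div_card]
  refine Continuous.div_const (continuous_finsetSum _ fun x _ => ?_) _
  exact (continuous_apply (∑ i ∈ e, x i)).mul continuous_const

/-- The set `K₂ = {h : ‖h‖ ≤ t}` of the proof of Thm. 5.1 is closed.
[cite: ConlonFoxZhao2014, proof of Theorem 5.1] -/
theorem isClosed_setOf_hasSmallCut (e : Finset ι) (t : ℝ) :
    IsClosed {h : ZMod N → ℝ | HasSmallCut e (fun x : ι → ZMod N => h (∑ i ∈ e, x i)) t} := by
  have : {h : ZMod N → ℝ | HasSmallCut e (fun x : ι → ZMod N => h (∑ i ∈ e, x i)) t} =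
      ⋂ a : ι → (ι → ZMod N) → ℝ, ⋂ (_ : IsCutFamily e a),
        {h | |cutAverage e (fun x : ι → ZMod N => h (∑ i ∈ e, x i)) a| ≤ t} := by
    ext h
    simp only [Set.mem_setOf_eq, Set.mem_iInter, HasSmallCut]
  rw [this]
  exact isClosed_iInter fun a => isClosed_iInter fun _ =>
    isClosed_le (continuous_cutAverage_comp_sum e a).abs continuous_const

/-- The set `K₂` is convex. [cite: ConlonFoxZhao2014, proof of Theorem 5.1] -/
theorem convex_setOf_hasSmallCut (e : Finset ι) (t : ℝ) :
    Convex ℝ {h : ZMod N → ℝ | HasSmallCut e (fun x : ι → ZMod N => h (∑ i ∈ e, x i)) t} := by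
  intro h₁ hh₁ h₂ hh₂ p q hp hq hpq a ha
  have h1 := hh₁ a ha
  have h2 := hh₂ a ha
  have : cutAverage e (fun x : ι → ZMod N => (p • h₁ + q • h₂) (∑ i ∈ e, x i)) a =
      p * cutAverage e (fun x : ι → ZMod N => h₁ (∑ i ∈ e, x i)) a +
        q * cutAverage e (fun x : ι → ZMod N => h₂ (∑ i ∈ e, x i)) a := by
    rw [← cutAverage_const_mul, ← cutAverage_const_mul, ← cutAverage_add]
    rfl
  rw [this]
  calc |p * cutAverage e (fun x : ι → ZMod N => h₁ (∑ i ∈ e, x i)) a +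
        q * cutAverage e (fun x : ι → ZMod N => h₂ (∑ i ∈ e, x i)) a|
      ≤ p * t + q * t := (abs_add_le _ _).trans (by
        rw [abs_mul, abs_mul, abs_of_nonneg hp, abs_of_nonneg hq]
        exact add_le_add (mul_le_mul_of_nonneg_left h1 hp) (mul_le_mul_of_nonneg_left h2 hq))
    _ = t := by rw [← add_mul, hpq, one_mul]

/-- **The separating functional** of the proof of Thm. 5.1: if no `f̃` with values in `[0, c]`
has `‖f - f̃‖ ≤ t`, then (separating the compact convex set `f - K₁` from the closed convex
`K₂` by the Hahn–Banach theorem and normalising) there is `ψ` with (a) `⟨f, ψ⟩ > 1` and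
(b) `⟨g + h, ψ⟩ < 1` for all `g ∈ K₁ = [0,c]^{ℤ_N}`, `h ∈ K₂ = {‖h‖ ≤ t}`.
[cite: ConlonFoxZhao2014, proof of Theorem 5.1] -/
theorem exists_separating {e : Finset ι} (f : ZMod N → ℝ) {c t : ℝ} (hc : 0 ≤ c) (ht : 0 ≤ t)
    (hcon : ∀ ft : ZMod N → ℝ, (∀ z, 0 ≤ ft z) → (∀ z, ft z ≤ c) →
      ¬ HasSmallCut e (fun x : ι → ZMod N => f (∑ i ∈ e, x i) - ft (∑ i ∈ e, x i)) t) :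
    ∃ ψ : ZMod N → ℝ, 1 < dmInner f ψ ∧
      ∀ g h : ZMod N → ℝ, (∀ z, 0 ≤ g z ∧ g z ≤ c) →
        HasSmallCut e (fun x : ι → ZMod N => h (∑ i ∈ e, x i)) t → dmInner (g + h) ψ < 1 := by
  set K1 : Set (ZMod N → ℝ) := {g | ∀ z, 0 ≤ g z ∧ g z ≤ c} with hK1
  set K2 : Set (ZMod N → ℝ) :=
    {h | HasSmallCut e (fun x : ι → ZMod N => h (∑ i ∈ e, x i)) t} with hK2
  set S : Set (ZMod N → ℝ) := (fun g => f - g) '' K1 with hS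
  have hK1c : IsCompact K1 := by
    have : K1 = Set.Icc (0 : ZMod N → ℝ) (fun _ => c) := by
      ext g
      simp only [hK1, Set.mem_setOf_eq, Set.mem_Icc, Pi.le_def, Pi.zero_apply]
      exact ⟨fun h => ⟨fun z => (h z).1, fun z => (h z).2⟩, fun h z => ⟨h.1 z, h.2 z⟩⟩
    rw [this]
    exact isCompact_Icc
  have hSc : IsCompact S := hK1c.image (continuous_const.sub continuous_id)
  have hSconv : Convex ℝ S := by
    rintro _ ⟨g₁, hg₁, rfl⟩ _ ⟨g₂, hg₂, rfl⟩ p q hp hq hpq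
    refine ⟨p • g₁ + q • g₂, fun z => ⟨?_, ?_⟩, ?_⟩
    · simp only [Pi.add_apply, Pi.smul_apply, smul_eq_mul]
      nlinarith [(hg₁ z).1, (hg₂ z).1]
    · simp only [Pi.add_apply, Pi.smul_apply, smul_eq_mul]
      nlinarith [(hg₁ z).2, (hg₂ z).2]
    · funext z
      simp only [Pi.add_apply, Pi.smul_apply, Pi.sub_apply, smul_eq_mul]
      have : p + q = 1 := hpq
      linear_combination (-(f z)) * this
  have hdisj : Disjoint S K2 := by
    rw [Set.disjoint_left]
    rintro _ ⟨g, hg, rfl⟩ hK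
    exact hcon g (fun z => (hg z).1) (fun z => (hg z).2) hK
  obtain ⟨L, u, v, hLu, huv, hLv⟩ := geometric_hahn_banach_compact_closed hSconv hSc
    (convex_setOf_hasSmallCut e t) (isClosed_setOf_hasSmallCut e t) hdisj
  obtain ⟨h₀, hh₀⟩ := exists_dmInner_eq L
  have h0K1 : (0 : ZMod N → ℝ) ∈ K1 := fun z => ⟨le_rfl, hc⟩
  have h0K2 : (0 : ZMod N → ℝ) ∈ K2 := by
    show HasSmallCut e (fun x : ι → ZMod N => (0 : ZMod N → ℝ) (∑ i ∈ e, x i)) t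
    exact hasSmallCut_of_abs_le fun x => by simp only [Pi.zero_apply, abs_zero]; exact ht
  have hLf : L f < u := hLu f ⟨0, h0K1, sub_zero f⟩
  have hL0 : v < 0 := by simpa using hLv 0 h0K2
  -- `Λ = -L`, threshold `θ = (u - v) - L f > 0`, `ψ = -h₀ / θ`
  set θ : ℝ := (u - v) - L f with hθ
  have hθpos : 0 < θ := by rw [hθ]; linarith
  refine ⟨fun z => -h₀ z / θ, ?_, ?_⟩
  · have hψL : dmInner f (fun z => -h₀ z / θ) = -L f / θ := by
      rw [hh₀]
      unfold dmInner
      rw [← Finset.expect_neg_distrib, Finset.expect_div]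
      exact Finset.expect_congr rfl fun z _ => by ring
    rw [hψL, lt_div_iff₀ hθpos, hθ]; linarith
  · intro g h hg hh
    have h1 := hLu (f - g) ⟨g, hg, rfl⟩
    have h2 := hLv h hh
    have hψL : dmInner (g + h) (fun z => -h₀ z / θ) = -L (g + h) / θ := by
      rw [hh₀]
      unfold dmInner
      rw [← Finset.expect_neg_distrib, Finset.expect_div]
      exact Finset.expect_congr rfl fun z _ => by ring
    rw [hψL, div_lt_one hθpos, hθ, map_add]
    rw [map_sub] at h1
    linarith

/-- **The dual norm bound `‖ψ‖* ≤ 2/ε`** (proof of Thm. 5.1: "ranging `g` over `K₂`, we obtain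
`‖ψ‖_∞ ≤ ‖ψ‖* ≤ 2/ε`"), from property (b) of the separating functional.
[cite: ConlonFoxZhao2014, proof of Theorem 5.1] -/
theorem dual_bound_of_separating {e : Finset ι} {ψ : ZMod N → ℝ} {c t : ℝ} (hc : 0 ≤ c)
    (ht : 0 < t)
    (hb : ∀ g h : ZMod N → ℝ, (∀ z, 0 ≤ g z ∧ g z ≤ c) →
      HasSmallCut e (fun x : ι → ZMod N => h (∑ i ∈ e, x i)) t → dmInner (g + h) ψ < 1)
    (h : ZMod N → ℝ) (s : ℝ) (hs : 0 < s)
    (hcut : HasSmallCut e (fun x : ι → ZMod N => h (∑ i ∈ e, x i)) s) :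
    |dmInner h ψ| ≤ t⁻¹ * s := by
  have key : ∀ h' : ZMod N → ℝ,
      HasSmallCut e (fun x : ι → ZMod N => h' (∑ i ∈ e, x i)) s → dmInner h' ψ < t⁻¹ * s := by
    intro h' hcut'
    have hmem : HasSmallCut e (fun x : ι → ZMod N => t / s * h' (∑ i ∈ e, x i)) t := by
      refine (hcut'.const_mul (t / s)).mono (le_of_eq ?_)
      rw [abs_of_pos (by positivity), div_mul_cancel₀ _ hs.ne']
    have h1 := hb 0 (fun z => t / s * h' z) (fun z => ⟨le_rfl, hc⟩) hmem
    rw [zero_add] at h1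
    have h2 : dmInner (fun z => t / s * h' z) ψ = t / s * dmInner h' ψ := by
      unfold dmInner; rw [Finset.mul_expect]
      exact Finset.expect_congr rfl fun z _ => by ring
    rw [h2] at h1
    have h3 : 0 < t / s := by positivity
    calc dmInner h' ψ = (t / s * dmInner h' ψ) / (t / s) := by field_simp
      _ < 1 / (t / s) := by gcongr
      _ = t⁻¹ * s := by field_simp
  rw [abs_le]
  constructor
  · have := key (fun z => -h z) (by simpa using hcut.neg)
    have hn : dmInner (fun z => -h z) ψ = -dmInner h ψ := by
      unfold dmInner; rw [← Finset.expect_neg_distrib]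
      exact Finset.expect_congr rfl fun z _ => by ring
    rw [hn] at this
    linarith
  · exact (key h hcut).le

/-- The numerical inequality concluding the proof of Thm. 5.1 ("Since `ε ≤ 1/10`, the right-hand
side is at most `1` when `ε'` is made sufficiently small").
[cite: ConlonFoxZhao2014, proof of Theorem 5.1] -/
theorem dm_numeric {ε₀ ε' a : ℝ} (hε₀ : 0 < ε₀) (hε₀1 : ε₀ ≤ 1 / 10) (_hε'0 : 0 ≤ ε')
    (hε' : ε' ≤ ε₀ / 8) (ha : (1 + ε₀ / 2) * a < 1) :
    a + ε₀ / 8 + ε₀ / 8 + ε₀ / 8 * (1 + ε') < 1 := by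
  have h1 : a < 1 - ε₀ / 2 + ε₀ ^ 2 / 4 := by nlinarith
  have h2 : ε₀ ^ 2 ≤ ε₀ / 10 := by nlinarith
  have h3 : ε₀ * ε' ≤ ε₀ / 80 := by nlinarith
  nlinarith

/-- **The heart of the proof of Thm. 5.1**: with `ε₀ ≤ 1/10`, `M = 2/ε₀`, a polynomial `P` with
`|P(x) - x₊| < ε₀/8` on `[-M, M]`, `R = ∑ |p_i| M^i` and `ε' ≤ ε₀/8`, `ε' R ≤ ε₀/8`: if
`‖ν - 1‖ ≤ ε'` and `0 ≤ f ≤ ν`, some `f̃ : ℤ_N → [0, 1 + ε₀/2]` has `‖f - f̃‖ ≤ ε₀/2`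
(otherwise the separating `ψ` satisfies `1 < ⟨f,ψ⟩ ≤ ⟨ν,ψ₊⟩ ≤ ⟨ν,Pψ⟩ + ‖ν‖₁ ε₀/8 ≤
(1+ε₀/2)⁻¹ + ε₀/8 + ε'R + (1+ε')ε₀/8 ≤ 1`). [cite: ConlonFoxZhao2014, proof of Theorem 5.1] -/
theorem exists_predense_model {e : Finset ι} (he : e.Nonempty) {ε₀ ε' R : ℝ} {P : Polynomial ℝ}
    (hε₀ : 0 < ε₀) (hε₀1 : ε₀ ≤ 1 / 10)
    (hP : ∀ x ∈ Set.Icc (-(2 / ε₀)) (2 / ε₀), |P.eval x - max x 0| < ε₀ / 8)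
    (hR : R = ∑ i ∈ Finset.range (P.natDegree + 1), |P.coeff i| * (2 / ε₀) ^ i)
    (hε'pos : 0 < ε') (hε'R : ε' * R ≤ ε₀ / 8) (hε'small : ε' ≤ ε₀ / 8)
    {ν f : ZMod N → ℝ} (hν : ∀ z, 0 ≤ ν z)
    (hν1 : HasSmallCut e (fun x : ι → ZMod N => ν (∑ i ∈ e, x i) - 1) ε')
    (hf0 : ∀ z, 0 ≤ f z) (hfν : ∀ z, f z ≤ ν z) :
    ∃ ft : ZMod N → ℝ, (∀ z, 0 ≤ ft z) ∧ (∀ z, ft z ≤ 1 + ε₀ / 2) ∧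
      HasSmallCut e (fun x : ι → ZMod N => f (∑ i ∈ e, x i) - ft (∑ i ∈ e, x i)) (ε₀ / 2) := by
  by_contra hcon
  push Not at hcon
  set M : ℝ := 2 / ε₀ with hMdef
  have hM : 0 < M := by positivity
  obtain ⟨ψ, ha, hb⟩ := exists_separating f (by positivity : (0 : ℝ) ≤ 1 + ε₀ / 2)
    (by positivity : (0 : ℝ) ≤ ε₀ / 2) hcon
  -- (b1) `(1 + ε₀/2) 𝔼 ψ₊ < 1`
  have hb1 : (1 + ε₀ / 2) * 𝔼 z, max (ψ z) 0 < 1 := by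
    have hg : ∀ z, 0 ≤ (if 0 < ψ z then 1 + ε₀ / 2 else (0 : ℝ)) ∧
        (if 0 < ψ z then 1 + ε₀ / 2 else (0 : ℝ)) ≤ 1 + ε₀ / 2 := by
      intro z
      split_ifs
      · exact ⟨by positivity, le_rfl⟩
      · exact ⟨le_rfl, by positivity⟩
    have h0 : HasSmallCut e (fun x : ι → ZMod N => (0 : ZMod N → ℝ) (∑ i ∈ e, x i)) (ε₀ / 2) :=
      hasSmallCut_of_abs_le fun x => by simp only [Pi.zero_apply, abs_zero]; positivity
    have := hb (fun z => if 0 < ψ z then 1 + ε₀ / 2 else 0) 0 hg h0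
    rw [add_zero] at this
    unfold dmInner at this
    rw [Finset.mul_expect]
    convert this using 2 with z
    show (1 + ε₀ / 2) * max (ψ z) 0 = (if 0 < ψ z then 1 + ε₀ / 2 else 0) * ψ z
    by_cases h : 0 < ψ z
    · rw [if_pos h, max_eq_left h.le]
    · rw [if_neg h, max_eq_right (not_lt.mp h)]; ring
  -- (b2) the dual norm bound `‖ψ‖* ≤ M`
  have hdual : ∀ (h : ZMod N → ℝ) (s : ℝ), 0 < s →
      HasSmallCut e (fun x : ι → ZMod N => h (∑ i ∈ e, x i)) s → |dmInner h ψ| ≤ M * s := by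
    intro h s hs hcut
    have := dual_bound_of_separating (by positivity : (0 : ℝ) ≤ 1 + ε₀ / 2)
      (by positivity : (0 : ℝ) < ε₀ / 2) hb h s hs hcut
    rw [inv_div] at this
    rw [hMdef]
    exact this
  -- `‖ψ‖_∞ ≤ M` and the Weierstrass polynomial on the range of `ψ`
  have hψM : ∀ z, |ψ z| ≤ M := abs_le_of_dual he hdual
  have hPψ : ∀ z, |P.eval (ψ z) - max (ψ z) 0| < ε₀ / 8 := fun z =>
    hP (ψ z) (Set.mem_Icc.mpr (abs_le.mp (hψM z)))
  -- `|⟨ν - 1, Pψ⟩| ≤ ε' R`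
  have hνP : |dmInner (fun z => ν z - 1) (fun z => P.eval (ψ z))| ≤ ε' * R := by
    have hexp : dmInner (fun z => ν z - 1) (fun z => P.eval (ψ z)) =
        ∑ i ∈ Finset.range (P.natDegree + 1),
          P.coeff i * dmInner (fun z => ν z - 1) (ψ ^ i) := by
      unfold dmInner
      have : ∀ z, (ν z - 1) * P.eval (ψ z) =
          ∑ i ∈ Finset.range (P.natDegree + 1), P.coeff i * ((ν z - 1) * (ψ ^ i) z) := by
        intro z
        rw [Polynomial.eval_eq_sum_range, Finset.mul_sum]
        exact Finset.sum_congr rfl fun i _ => by simp only [Pi.pow_apply]; ring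
      simp_rw [this]
      rw [Finset.expect_sum_comm]
      exact Finset.sum_congr rfl fun i _ => (Finset.mul_expect _ _ _).symm
    rw [hexp]
    refine (Finset.abs_sum_le_sum_abs _ _).trans ?_
    rw [hR, Finset.mul_sum]
    refine Finset.sum_le_sum fun i _ => ?_
    rw [abs_mul]
    calc |P.coeff i| * |dmInner (fun z => ν z - 1) (ψ ^ i)| ≤ |P.coeff i| * (M ^ i * ε') :=
          mul_le_mul_of_nonneg_left
            (abs_dmInner_pow_le (h := fun z => ν z - 1) he hM hdual hν1 i) (abs_nonneg _)
      _ = ε' * (|P.coeff i| * M ^ i) := by ring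
  -- `𝔼 ν ≤ 1 + ε'`
  have hEν : 𝔼 z, ν z ≤ 1 + ε' := by
    have := HasSmallCut.abs_expect_le_of_sum (F := fun z => ν z - 1) he hν1
    rw [Finset.expect_sub_distrib, Finset.expect_const Finset.univ_nonempty] at this
    linarith [(abs_le.mp this).2]
  -- the chain of inequalities
  have s1 : dmInner f ψ ≤ 𝔼 z, ν z * max (ψ z) 0 := by
    unfold dmInner
    refine Finset.expect_le_expect fun z _ => ?_
    calc f z * ψ z ≤ f z * max (ψ z) 0 := mul_le_mul_of_nonneg_left (le_max_left _ _) (hf0 z)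
      _ ≤ ν z * max (ψ z) 0 := mul_le_mul_of_nonneg_right (hfν z) (le_max_right _ _)
  have s2 : (𝔼 z, ν z * max (ψ z) 0) ≤ 𝔼 z, ν z * (P.eval (ψ z) + ε₀ / 8) :=
    Finset.expect_le_expect fun z _ => mul_le_mul_of_nonneg_left
      (by linarith [(abs_lt.mp (hPψ z)).1]) (hν z)
  have s3 : (𝔼 z, ν z * (P.eval (ψ z) + ε₀ / 8)) =
      (𝔼 z, P.eval (ψ z)) + dmInner (fun z => ν z - 1) (fun z => P.eval (ψ z)) +
        ε₀ / 8 * 𝔼 z, ν z := by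
    unfold dmInner
    rw [Finset.mul_expect, ← Finset.expect_add_distrib, ← Finset.expect_add_distrib]
    exact Finset.expect_congr rfl fun z _ => by ring
  have s4 : (𝔼 z, P.eval (ψ z)) ≤ (𝔼 z, max (ψ z) 0) + ε₀ / 8 := by
    calc (𝔼 z, P.eval (ψ z)) ≤ 𝔼 z, (max (ψ z) 0 + ε₀ / 8) :=
          Finset.expect_le_expect fun z _ => by linarith [(abs_lt.mp (hPψ z)).2]
      _ = (𝔼 z, max (ψ z) 0) + ε₀ / 8 := by
          rw [Finset.expect_add_distrib,
            Finset.expect_const (Finset.univ_nonempty (α := ZMod N))]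
  have s5 := (abs_le.mp hνP).2
  have s6 : ε₀ / 8 * 𝔼 z, ν z ≤ ε₀ / 8 * (1 + ε') :=
    mul_le_mul_of_nonneg_left hEν (by positivity)
  have hfin := dm_numeric hε₀ hε₀1 hε'pos.le hε'small hb1
  linarith only [ha, s1, s2, s3, s4, s5, s6, hfin, hε'R]

/-- **Conlon–Fox–Zhao, Theorem 5.1 (dense model theorem) — proof.** Following §5 of the source:
WLOG `ε ≤ 1/10`; choose by the Weierstrass approximation theorem a polynomial `P` with
`|P(x) - x₊| ≤ ε/8` on `[-2/ε, 2/ε]`, put `R = ∑ |p_i| (2/ε)^i` and `ε' = ε/(8(R+1))`; then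
`exists_predense_model` (the separation argument) gives `f̃ : ℤ_N → [0, 1 + ε/2]` with
`‖f - f̃‖ ≤ ε/2`, and `f̃ ∧ 1` is the dense model. [cite: ConlonFoxZhao2014, Theorem 5.1] -/
theorem denseModel_holds : DenseModel := by
  intro ι _ _ e ε hε
  classical
  rcases e.eq_empty_or_nonempty with rfl | he
  · -- degenerate case `e = ∅`: the cut norm of `F` is `|F(0)|`
    refine ⟨ε, hε, fun N _ ν hν hν1 f hf0 hfν => ?_⟩
    refine ⟨fun z => min (f z) 1, fun z => le_min (hf0 z) zero_le_one,
      fun z => min_le_right _ _, fun a ha => ?_⟩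
    have h1 := hν1 a ha
    simp only [cutAverage, Finset.sum_empty, Finset.prod_empty, mul_one] at h1 ⊢
    rw [Finset.expect_const Finset.univ_nonempty] at h1 ⊢
    have h2 := (abs_le.mp h1).2
    rw [abs_le]
    constructor
    · linarith [min_le_left (f 0) 1]
    · rcases le_or_gt (f 0) 1 with h | h
      · rw [min_eq_left h]; linarith
      · rw [min_eq_right h.le]; linarith [hfν 0]
  -- constants: `ε₀ = min ε 1/10`, the Weierstrass polynomial `P`, `R`, `ε'`
  set ε₀ : ℝ := min ε (1 / 10) with hε₀def
  have hε₀ : 0 < ε₀ := lt_min hε (by norm_num)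
  have hε₀ε : ε₀ ≤ ε := min_le_left _ _
  have hε₀1 : ε₀ ≤ 1 / 10 := min_le_right _ _
  obtain ⟨P, hP⟩ := exists_polynomial_near_of_continuousOn (-(2 / ε₀)) (2 / ε₀)
    (fun t => max t 0) ((continuous_id.max continuous_const).continuousOn) (ε₀ / 8)
    (by positivity)
  set R : ℝ := ∑ i ∈ Finset.range (P.natDegree + 1), |P.coeff i| * (2 / ε₀) ^ i with hRdef
  have hR : 0 ≤ R := Finset.sum_nonneg fun i _ => by positivity
  have hε'pos : 0 < ε₀ / (8 * (R + 1)) := by positivity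
  have hε'R : ε₀ / (8 * (R + 1)) * R ≤ ε₀ / 8 := by
    rw [div_mul_eq_mul_div, div_le_div_iff₀ (by positivity) (by norm_num)]
    nlinarith
  have hε'small : ε₀ / (8 * (R + 1)) ≤ ε₀ / 8 := by
    rw [div_le_div_iff₀ (by positivity) (by norm_num)]
    nlinarith
  refine ⟨ε₀ / (8 * (R + 1)), hε'pos, fun N _ ν hν hν1 f hf0 hfν => ?_⟩
  obtain ⟨ft, hft0, hft1, hcut⟩ :=
    exists_predense_model he hε₀ hε₀1 hP hRdef hε'pos hε'R hε'small hν hν1 hf0 hfν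
  -- the dense model: cap `f̃` at `1`
  refine ⟨fun z => min (ft z) 1, fun z => le_min (hft0 z) zero_le_one,
    fun z => min_le_right _ _, ?_⟩
  have hcap : HasSmallCut e
      (fun x : ι → ZMod N => ft (∑ i ∈ e, x i) - min (ft (∑ i ∈ e, x i)) 1) (ε₀ / 2) := by
    refine hasSmallCut_of_abs_le fun x => ?_
    rw [abs_le]
    constructor
    · linarith [min_le_left (ft (∑ i ∈ e, x i)) 1]
    · rcases le_or_gt (ft (∑ i ∈ e, x i)) 1 with h | h
      · rw [min_eq_left h]; linarith
      · rw [min_eq_right h.le]; linarith [hft1 (∑ i ∈ e, x i)]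
  have hsum := (hcut.add hcap).mono (by linarith : ε₀ / 2 + ε₀ / 2 ≤ ε)
  refine fun a ha => (le_of_eq ?_).trans (hsum a ha)
  congr 1
  refine congrArg (fun F => cutAverage e F a) (funext fun x => ?_)
  ring

end DenseModelTheorem

end Literature.Combinatorics.Additive.CFZ
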